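import Mathlib
import Summits.ResolutionOfSingularities.ResolutionOfSingularities.Theorems.WildQuotientsKiralyLutkebohmertConjectureNineThree
import HarnessLib

/-!
# Király–Lütkebohmert (ANT 7 (2013)), §3: Conjecture 9 holds for `p = 3` (general residue field)

Route `ResolutionOfSingularities/WildQuotients`; helper toward the depth-0 / kill-criterion dictionary
of the crux `CyclicQuotientFourfolds` (stmt-ResolutionOfSingularities-17941, research stub
`stub_reachLowerInFX`; memo `KL-CONJ9-STATUS.md`, item 1). F. Király, W. Lütkebohmert, *Group actions
of prime order on local normal rings*, ANT 7 (2013) 63–74, §3, Conjecture 9 and the proof of the case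
`p = 3` (pp. 70–71): for a regular local ring `B` with a `3`-cyclic action such that the fixed ring
`A` is regular (and `B` module-finite over `A`), the augmentation ideal is principal.

The residue-trivial case is `kl_conjecture9_three_of_residue` (`…ConjectureNineThree`); the
remaining case `ū ∉ k_A` is argued with EXACT relations in `B` (no residue-field degrees): with
`B = A + Au + Av`, `v̄ ∈ k_A + k_A ū` is impossible (`(u − a)v′ ∈ 𝔪_A B`, `u − a` a unit, forces
`v′ ∈ 𝔪_A B`, contradicting the basis property), and otherwise the relations `u² = α + βu + γv`,
`v² = α′ + β′u + γ′v`, `uv = α″ + β″u + γ″v` give `B = A[u]` (`γ` a unit) or `B = A[v]` (`β′` a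
unit), the case `γ, β′ ∈ 𝔪_A` being contradictory; monogenous ⇒ principal is Thm. 2 (b) ⇒ (a).

* `kl_exists_two_generators_of_basis_three'` (unit trick), `kl_coeff_mem_maximalIdeal_of_mem_map`
  (basis property of `1, u, v`), `kl_conjecture9_three_core` (case `ū ∉ k_A`), `kl_conjecture9_three`
  — **Conjecture 9 for `p = 3`** — and the iff `kl_isRegularLocalRing_fixed_iff_isPrincipal_three`.
  [cite: KiralyLutkebohmert2013, §3 Conjecture 9 (case p = 3), pp. 70–71]

[OURS · crux stmt-ResolutionOfSingularities-17941 · helper (def-free); printed statement of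
KiralyLutkebohmert2013 §3 (case `p = 3`), different (induction-free) proof; counted 0; AI-level work,
weaker than expert review.]
-/

-- single-problem summit: the doubled namespace component `ResolutionOfSingularities` is forced
set_option linter.dupNamespace false

open IsLocalRing Submodule Literature.AlgebraicGeometry.Resolution

namespace Summit.ResolutionOfSingularities.ResolutionOfSingularities.Theorems

universe u

section UnitTrick

variable {B : Type*} [CommRing B] [IsLocalRing B]

/-- **Unit trick** (no residue hypothesis): an `A`-basis of size `3` of the local ring `B` over the
fixed ring `A = B^σ` yields `u, v` with `B = A + Au + Av`. [folklore; KiralyLutkebohmert2013 §3] -/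
theorem kl_exists_two_generators_of_basis_three' (σ : B ≃+* B)
    (bs : Module.Basis (Fin 3) ((σ : B →+* B).eqLocus (RingHom.id B)) B) :
    ∃ u v : B,
      ∀ b : B, ∃ a a₁ a₂ : (σ : B →+* B).eqLocus (RingHom.id B), b = a + a₁ * u + a₂ * v := by
  classical
  set A : Subring B := (σ : B →+* B).eqLocus (RingHom.id B) with hA_def
  have hrep : ∀ b : B, ∃ c₀ c₁ c₂ : A, b = c₀ * bs 0 + c₁ * bs 1 + c₂ * bs 2 := by
    intro b
    refine ⟨bs.repr b 0, bs.repr b 1, bs.repr b 2, ?_⟩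
    conv_lhs => rw [← bs.sum_repr b]
    simp only [Fin.sum_univ_three, Subring.smul_def, smul_eq_mul]
  have step : ∀ e₀ e₁ e₂ : B, (∀ b : B, ∃ c₀ c₁ c₂ : A, b = c₀ * e₀ + c₁ * e₁ + c₂ * e₂) →
      ∀ c₀ c₁ c₂ : A, (1 : B) = c₀ * e₀ + c₁ * e₁ + c₂ * e₂ → IsUnit ((c₀ : B) * e₀) →
      ∀ b : B, ∃ a a₁ a₂ : A, b = a + a₁ * e₁ + a₂ * e₂ := by
    intro e₀ e₁ e₂ hrep3 c₀ c₁ c₂ h1 hu b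
    have hc₀ : IsUnit c₀ := isUnit_invariants_of_isUnit σ (isUnit_of_mul_isUnit_left hu)
    obtain ⟨w, hw⟩ := hc₀.exists_left_inv
    have hw' : (w : B) * c₀ = 1 := by
      have := congrArg Subtype.val hw
      simpa using this
    have he₀ : e₀ = w * (1 - c₁ * e₁ - c₂ * e₂) := by
      have h1' : (c₀ : B) * e₀ = 1 - c₁ * e₁ - c₂ * e₂ := by linear_combination (-1 : B) * h1
      calc e₀ = ((w : B) * c₀) * e₀ := by rw [hw', one_mul]
        _ = w * (c₀ * e₀) := by ring
        _ = w * (1 - c₁ * e₁ - c₂ * e₂) := by rw [h1']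
    obtain ⟨d₀, d₁, d₂, hb⟩ := hrep3 b
    refine ⟨d₀ * w, d₁ - d₀ * w * c₁, d₂ - d₀ * w * c₂, ?_⟩
    rw [hb, he₀]
    push_cast
    ring
  obtain ⟨c₀, c₁, c₂, h1⟩ := hrep 1
  have hsome : IsUnit ((c₀ : B) * bs 0) ∨ IsUnit ((c₁ : B) * bs 1) ∨ IsUnit ((c₂ : B) * bs 2) := by
    by_contra h
    push Not at h
    obtain ⟨h0, h1'', h2⟩ := h
    have hm : (c₀ : B) * bs 0 + c₁ * bs 1 + c₂ * bs 2 ∈ maximalIdeal B :=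
      add_mem (add_mem ((mem_maximalIdeal _).mpr h0) ((mem_maximalIdeal _).mpr h1''))
        ((mem_maximalIdeal _).mpr h2)
    rw [← h1] at hm
    exact (maximalIdeal.isMaximal B).ne_top (Ideal.eq_top_of_isUnit_mem _ hm isUnit_one)
  rcases hsome with h | h | h
  · exact ⟨bs 1, bs 2, step (bs 0) (bs 1) (bs 2) hrep c₀ c₁ c₂ h1 h⟩
  · refine ⟨bs 0, bs 2, step (bs 1) (bs 0) (bs 2) (fun b => ?_) c₁ c₀ c₂ (by rw [h1]; ring) h⟩
    obtain ⟨d₀, d₁, d₂, hb⟩ := hrep b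
    exact ⟨d₁, d₀, d₂, by rw [hb]; ring⟩
  · refine ⟨bs 0, bs 1, step (bs 2) (bs 0) (bs 1) (fun b => ?_) c₂ c₀ c₁ (by rw [h1]; ring) h⟩
    obtain ⟨d₀, d₁, d₂, hb⟩ := hrep b
    exact ⟨d₂, d₀, d₁, by rw [hb]; ring⟩

omit [IsLocalRing B] in
/-- **Coordinates of `𝔪_A B` w.r.t. a spanning triple `1, u, v`**: if `B = A + Au + Av` for the
fixed ring `A = B^σ` (Noetherian local) and `B` has an `A`-basis of size `3`, then
`a₀ + a₁u + a₂v ∈ 𝔪_A B` forces `a₀, a₁, a₂ ∈ 𝔪_A` — the spanning triple is itself a basis, a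
surjective endomorphism of the Noetherian module `A³` being injective. [folklore] -/
theorem kl_coeff_mem_maximalIdeal_of_mem_map (σ : B ≃+* B)
    [IsNoetherianRing ((σ : B →+* B).eqLocus (RingHom.id B))]
    [IsLocalRing ((σ : B →+* B).eqLocus (RingHom.id B))]
    (bs : Module.Basis (Fin 3) ((σ : B →+* B).eqLocus (RingHom.id B)) B) (u v : B)
    (hgen : ∀ b : B, ∃ a a₁ a₂ : (σ : B →+* B).eqLocus (RingHom.id B), b = a + a₁ * u + a₂ * v)
    (a₀ a₁ a₂ : (σ : B →+* B).eqLocus (RingHom.id B))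
    (h : (a₀ : B) + a₁ * u + a₂ * v ∈
      Ideal.map (algebraMap ((σ : B →+* B).eqLocus (RingHom.id B)) B)
        (maximalIdeal ((σ : B →+* B).eqLocus (RingHom.id B)))) :
    a₀ ∈ maximalIdeal ((σ : B →+* B).eqLocus (RingHom.id B)) ∧
      a₁ ∈ maximalIdeal ((σ : B →+* B).eqLocus (RingHom.id B)) ∧
      a₂ ∈ maximalIdeal ((σ : B →+* B).eqLocus (RingHom.id B)) := by
  classical
  -- the linear map `A³ → B`, `c ↦ c₀ + c₁ u + c₂ v`
  let φ : (Fin 3 → (σ : B →+* B).eqLocus (RingHom.id B)) →ₗ[(σ : B →+* B).eqLocus (RingHom.id B)] B :=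
    { toFun := fun c => (c 0 : B) + c 1 * u + c 2 * v
      map_add' := fun c d => by
        simp only [Pi.add_apply, Subring.coe_add]
        ring
      map_smul' := fun r c => by
        simp only [Pi.smul_apply, smul_eq_mul, Subring.coe_mul, RingHom.id_apply, Subring.smul_def]
        ring }
  have hφ : ∀ c : Fin 3 → (σ : B →+* B).eqLocus (RingHom.id B),
      φ c = (c 0 : B) + c 1 * u + c 2 * v := fun c => rfl
  have hsurj : Function.Surjective φ := by
    intro b
    obtain ⟨a, b₁, b₂, hb⟩ := hgen b
    exact ⟨![a, b₁, b₂], by rw [hφ, hb]; simp⟩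
  -- `ψ = repr ∘ φ` is a surjective endomorphism of the Noetherian module `A³`, hence injective
  let ψ : (Fin 3 → (σ : B →+* B).eqLocus (RingHom.id B)) →ₗ[(σ : B →+* B).eqLocus (RingHom.id B)]
      (Fin 3 → (σ : B →+* B).eqLocus (RingHom.id B)) := bs.equivFun.toLinearMap ∘ₗ φ
  have hψ : Function.Surjective ψ := bs.equivFun.surjective.comp hsurj
  have hψinj : Function.Injective ψ := IsNoetherian.injective_of_surjective_endomorphism ψ hψ
  have hφinj : Function.Injective φ := by
    intro c d hcd
    apply hψinj
    show bs.equivFun (φ c) = bs.equivFun (φ d)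
    rw [hcd]
  -- membership in `𝔪_A • B` gives coordinates in `𝔪_A`
  have hmem : (a₀ : B) + a₁ * u + a₂ * v ∈
      maximalIdeal ((σ : B →+* B).eqLocus (RingHom.id B)) •
        (⊤ : Submodule ((σ : B →+* B).eqLocus (RingHom.id B)) B) := by
    rw [Ideal.smul_top_eq_map]
    exact h
  have key : ∀ x ∈ maximalIdeal ((σ : B →+* B).eqLocus (RingHom.id B)) •
      (⊤ : Submodule ((σ : B →+* B).eqLocus (RingHom.id B)) B),
      ∃ m : Fin 3 → (σ : B →+* B).eqLocus (RingHom.id B),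
      (∀ i, m i ∈ maximalIdeal ((σ : B →+* B).eqLocus (RingHom.id B))) ∧ φ m = x := by
    intro x hx
    refine Submodule.smul_induction_on (p := fun x => ∃ m : Fin 3 → (σ : B →+* B).eqLocus (RingHom.id B),
      (∀ i, m i ∈ maximalIdeal ((σ : B →+* B).eqLocus (RingHom.id B))) ∧ φ m = x) hx ?_ ?_
    · intro r hr n _
      obtain ⟨c, rfl⟩ := hsurj n
      refine ⟨r • c, fun i => ?_, by rw [map_smul]⟩
      rw [Pi.smul_apply, smul_eq_mul]
      exact Ideal.mul_mem_right _ _ hr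
    · rintro x y ⟨m, hm, rfl⟩ ⟨m', hm', rfl⟩
      exact ⟨m + m', fun i => by rw [Pi.add_apply]; exact add_mem (hm i) (hm' i), by rw [map_add]⟩
  obtain ⟨m, hm, hmx⟩ := key _ hmem
  have heq : m = ![a₀, a₁, a₂] := by
    apply hφinj
    rw [hmx, hφ]
    simp
  refine ⟨?_, ?_, ?_⟩
  · have := hm 0
    rw [heq] at this
    simpa using this
  · have := hm 1
    rw [heq] at this
    simpa using this
  · have := hm 2
    rw [heq] at this
    simpa using this

end UnitTrick

section Main

variable {B : Type u} [CommRing B] [IsRegularLocalRing B]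

/-- **The case `ū ∉ k_A`** of Conjecture 9 for `p = 3`: with `B = A + Au + Av`,
`a₀ + a₁u + v ∉ 𝔪_A B` for all `a₀, a₁ ∈ A` (basis property) and `u − a ∉ 𝔪_B` for all `a ∈ A`,
the augmentation ideal is principal (indeed `B = A[u]` or `B = A[v]`; the other configurations
are contradictory). [cite: KiralyLutkebohmert2013, §3 (case p = 3, k_A ≠ k_B), p. 71] -/
theorem kl_conjecture9_three_core (σ : B ≃+* B)
    (u v : B)
    (hgen : ∀ b : B, ∃ a a₁ a₂ : (σ : B →+* B).eqLocus (RingHom.id B), b = a + a₁ * u + a₂ * v)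
    (hU : ∀ a₀ a₁ : (σ : B →+* B).eqLocus (RingHom.id B), (a₀ : B) + a₁ * u + v ∉
      Ideal.map (algebraMap ((σ : B →+* B).eqLocus (RingHom.id B)) B)
        (haveI := isLocalRing_invariants σ; maximalIdeal ((σ : B →+* B).eqLocus (RingHom.id B))))
    (hnu : ∀ a : (σ : B →+* B).eqLocus (RingHom.id B), u - a ∉ maximalIdeal B) :
    (Ideal.span (Set.range fun c : B => σ c - c)).IsPrincipal := by
  classical
  set A : Subring B := (σ : B →+* B).eqLocus (RingHom.id B) with hA_def
  haveI : IsLocalRing A := isLocalRing_invariants σ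
  set m := maximalIdeal B with hm_def
  set J : Ideal B := Ideal.map (algebraMap A B) (maximalIdeal A) with hJ_def
  have hAm : ∀ a : A, (a : B) ∈ m ↔ a ∈ maximalIdeal A :=
    fun a => (kl_mem_maximalIdeal_fixed_iff σ a).symm
  have hAJ : ∀ a : A, (a : B) ∈ m → (a : B) ∈ J :=
    fun a ha => Ideal.mem_map_of_mem _ ((hAm a).mp ha)
  have unitA : ∀ a : A, (a : B) ∉ m → ∃ w : A, (w : B) * a = 1 := by
    intro a ha
    have hu : IsUnit (a : B) := by
      by_contra h
      exact ha ((mem_maximalIdeal _).mpr h)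
    obtain ⟨w, hw⟩ := (isUnit_invariants_of_isUnit σ hu).exists_left_inv
    exact ⟨w, by simpa using congrArg Subtype.val hw⟩
  have hvmem : ∀ x : B, x ∈ Algebra.adjoin A ({x} : Set B) :=
    fun x => Algebra.subset_adjoin (Set.mem_singleton x)
  have hAmem : ∀ (x : B) (a : A), (a : B) ∈ Algebra.adjoin A ({x} : Set B) :=
    fun x a => Subalgebra.algebraMap_mem _ a
  -- (L1) `a₀ + a₁ u ∈ 𝔪_B ⟹ a₁, a₀ ∈ 𝔪_B`
  have L1 : ∀ a₀ a₁ : A, (a₀ : B) + a₁ * u ∈ m → (a₁ : B) ∈ m ∧ (a₀ : B) ∈ m := by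
    intro a₀ a₁ h
    have h1 : (a₁ : B) ∈ m := by
      by_contra hn
      obtain ⟨w, hw⟩ := unitA a₁ hn
      apply hnu (-(w * a₀))
      have e : u - ((-(w * a₀) : A) : B) = w * (a₀ + a₁ * u) := by
        push_cast
        linear_combination (-u) * hw
      rw [e]
      exact m.mul_mem_left _ h
    refine ⟨h1, ?_⟩
    have e : (a₀ : B) = (a₀ + a₁ * u) - a₁ * u := by ring
    rw [e]
    exact sub_mem h (m.mul_mem_right _ h1)
  by_cases h2a : ∃ α β : A, v - α - β * u ∈ m
  · -- (2a) residue degree two: impossible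
    exfalso
    obtain ⟨α, β, hv'⟩ := h2a
    set v' := v - α - β * u with hv'_def
    have hgen' : ∀ b : B, ∃ a a₁ a₂ : A, b = a + a₁ * u + a₂ * v' := by
      intro b
      obtain ⟨a, a₁, a₂, he⟩ := hgen b
      exact ⟨a + a₂ * α, a₁ + a₂ * β, a₂, by rw [he, hv'_def]; push_cast; ring⟩
    obtain ⟨a₀, a₁, a₂, he⟩ := hgen' (u * v')
    have huv : u * v' ∈ m := m.mul_mem_left _ hv'
    have h01 : (a₁ : B) ∈ m ∧ (a₀ : B) ∈ m := L1 a₀ a₁ (by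
      have e : (a₀ : B) + a₁ * u = u * v' - a₂ * v' := by rw [he]; ring
      rw [e]
      exact sub_mem huv (m.mul_mem_left _ hv'))
    have hJmem : (u - a₂) * v' ∈ J := by
      have e : (u - (a₂ : B)) * v' = a₀ + a₁ * u := by linear_combination he
      rw [e]
      exact add_mem (hAJ a₀ h01.2) (J.mul_mem_right _ (hAJ a₁ h01.1))
    have hunit : IsUnit (u - (a₂ : B)) := by
      by_contra hn
      exact hnu a₂ ((mem_maximalIdeal _).mpr hn)
    have hv'J : v' ∈ J := by
      obtain ⟨w, hw⟩ := hunit.exists_left_inv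
      have := J.mul_mem_left w hJmem
      rwa [← mul_assoc, hw, one_mul] at this
    apply hU (-α) (-β)
    have e : ((-α : A) : B) + ((-β : A) : B) * u + v = v' := by rw [hv'_def]; push_cast; ring
    rw [e]
    exact hv'J
  · -- (2b) `1, u, v` independent modulo `𝔪_B`
    push Not at h2a
    obtain ⟨α, β, γ, hu2⟩ := hgen (u * u)
    by_cases hγ : (γ : B) ∈ m
    · obtain ⟨α', β', γ', hv2⟩ := hgen (v * v)
      by_cases hβ' : (β' : B) ∈ m
      · -- both `u`, `v` «quadratic»: contradiction
        exfalso
        obtain ⟨α'', β'', γ'', huv⟩ := hgen (u * v)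
        have e1 : (u - γ'') * v = α'' + β'' * u := by linear_combination huv
        have e2 : (u - γ'') * (u - (β - γ'')) = ((α : B) + γ'' * (β - γ'')) + γ * v := by
          linear_combination hu2
        by_cases hN : (α : B) + γ'' * (β - γ'') ∈ m
        · have hprod : (u - γ'') * (u - (β - γ'')) ∈ m := by
            rw [e2]
            exact add_mem hN (m.mul_mem_right _ hγ)
          rcases (maximalIdeal.isMaximal B).isPrime.mem_or_mem hprod with h | h
          · exact hnu γ'' h
          · exact hnu (β - γ'') (by push_cast; exact h)
        · obtain ⟨w, hw⟩ := unitA (α + γ'' * (β - γ'')) (by push_cast; exact hN)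
          have e4 : ((α : B) + γ'' * (β - γ'') + γ * v) * v = (u - (β - γ'')) * (α'' + β'' * u) := by
            linear_combination (u - ((β : B) - γ'')) * e1 - v * e2
          have e5 : ((α : B) + γ'' * (β - γ'')) * v =
              (β'' * α - (β - γ'') * α'') + (α'' + β'' * γ'') * u + (β'' * γ * v - γ * (v * v)) := by
            linear_combination e4 + (β'' : B) * hu2
          apply h2a (w * (β'' * α - (β - γ'') * α'')) (w * (α'' + β'' * γ''))
          have e6 : v - ((w * (β'' * α - (β - γ'') * α'') : A) : B) -
              ((w * (α'' + β'' * γ'') : A) : B) * u = w * (β'' * γ * v - γ * (v * v)) := by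
            push_cast at hw ⊢
            linear_combination (-v) * hw + (w : B) * e5
          rw [e6]
          exact m.mul_mem_left _ (sub_mem (m.mul_mem_right _ (m.mul_mem_left _ hγ))
            (m.mul_mem_right _ hγ))
      · -- `β'` a unit: `u ∈ A[v]`, `B = A[v]`
        obtain ⟨w, hw⟩ := unitA β' hβ'
        have hadj : Algebra.adjoin A ({v} : Set B) = ⊤ := by
          have hu_mem : u ∈ Algebra.adjoin A ({v} : Set B) := by
            have e : u = w * (v * v - α' - γ' * v) := by
              linear_combination (-u) * hw + (-(w : B)) * hv2
            rw [e]
            exact Subalgebra.mul_mem _ (hAmem v w) (Subalgebra.sub_mem _ (Subalgebra.sub_mem _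
              (Subalgebra.mul_mem _ (hvmem v) (hvmem v)) (hAmem v α'))
              (Subalgebra.mul_mem _ (hAmem v γ') (hvmem v)))
          rw [eq_top_iff]
          intro b _
          obtain ⟨a, a₁, a₂, hb⟩ := hgen b
          rw [hb]
          exact Subalgebra.add_mem _ (Subalgebra.add_mem _ (hAmem v a)
            (Subalgebra.mul_mem _ (hAmem v a₁) hu_mem)) (Subalgebra.mul_mem _ (hAmem v a₂) (hvmem v))
        exact ⟨⟨σ v - v, kl_augIdeal_eq_span_singleton_of_adjoin_eq_top σ v hadj⟩⟩
    · -- `γ` a unit: `v ∈ A[u]`, `B = A[u]`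
      obtain ⟨w, hw⟩ := unitA γ hγ
      have hadj : Algebra.adjoin A ({u} : Set B) = ⊤ := by
        have hv_mem : v ∈ Algebra.adjoin A ({u} : Set B) := by
          have e : v = w * (u * u - α - β * u) := by
            linear_combination (-v) * hw + (-(w : B)) * hu2
          rw [e]
          exact Subalgebra.mul_mem _ (hAmem u w) (Subalgebra.sub_mem _ (Subalgebra.sub_mem _
            (Subalgebra.mul_mem _ (hvmem u) (hvmem u)) (hAmem u α))
            (Subalgebra.mul_mem _ (hAmem u β) (hvmem u)))
        rw [eq_top_iff]
        intro b _
        obtain ⟨a, a₁, a₂, hb⟩ := hgen b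
        rw [hb]
        exact Subalgebra.add_mem _ (Subalgebra.add_mem _ (hAmem u a)
          (Subalgebra.mul_mem _ (hAmem u a₁) (hvmem u))) (Subalgebra.mul_mem _ (hAmem u a₂) hv_mem)
      exact ⟨⟨σ u - u, kl_augIdeal_eq_span_singleton_of_adjoin_eq_top σ u hadj⟩⟩

/-- **Király–Lütkebohmert, Conjecture 9 for `p = 3`** (proved in print, §3 pp. 70–71): let `B` be
a regular local ring with a ring automorphism `σ ≠ 1`, `σ³ = 1`, such that `B` is module-finite
over the fixed ring `A = B^σ`. If `A` is a regular local ring then the augmentation ideal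
`(σ c − c : c ∈ B)` is principal. [cite: KiralyLutkebohmert2013, §3 Conjecture 9 (case p = 3), pp. 70–71] -/
theorem kl_conjecture9_three (σ : B ≃+* B) (hσ3 : σ ^ 3 = 1) (hσ1 : σ ≠ 1)
    [IsRegularLocalRing ((σ : B →+* B).eqLocus (RingHom.id B))]
    [Module.Finite ((σ : B →+* B).eqLocus (RingHom.id B)) B] :
    (Ideal.span (Set.range fun c : B => σ c - c)).IsPrincipal := by
  classical
  set A : Subring B := (σ : B →+* B).eqLocus (RingHom.id B) with hA_def
  set m := maximalIdeal B with hm_def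
  haveI : IsDomain B := isDomain_of_isRegularLocalRing B
  haveI : Module.Free A B := kl_free_of_isRegularLocalRing_fixed σ
  obtain ⟨bs⟩ := kl_nonempty_basis_fin_of_free Nat.prime_three σ hσ3 hσ1
  obtain ⟨u, v, hgen⟩ := kl_exists_two_generators_of_basis_three' σ bs
  have hne : (1 : A) ∉ maximalIdeal A := fun h1 =>
    (maximalIdeal.isMaximal A).ne_top ((Ideal.eq_top_iff_one _).mpr h1)
  by_cases hu : ∃ a : A, u - a ∈ m
  · by_cases hv : ∃ a : A, v - a ∈ m
    · -- residue-trivial case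
      obtain ⟨au, hau⟩ := hu
      obtain ⟨av, hav⟩ := hv
      have hres : ∀ b : B, ∃ a : B, σ a = a ∧ b - a ∈ maximalIdeal B := by
        intro b
        obtain ⟨a, a₁, a₂, he⟩ := hgen b
        refine ⟨((a + a₁ * au + a₂ * av : A) : B), (a + a₁ * au + a₂ * av).2, ?_⟩
        have e : b - ((a + a₁ * au + a₂ * av : A) : B) = a₁ * (u - au) + a₂ * (v - av) := by
          rw [he]; push_cast; ring
        rw [e]
        exact add_mem (m.mul_mem_left _ hau) (m.mul_mem_left _ hav)
      exact kl_conjecture9_three_of_residue σ hσ3 hσ1 hres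
    · push Not at hv
      refine kl_conjecture9_three_core σ v u (fun b => ?_) (fun a₀ a₁ h => ?_) hv
      · obtain ⟨a, a₁, a₂, he⟩ := hgen b
        exact ⟨a, a₂, a₁, by rw [he]; ring⟩
      · have h' : (a₀ : B) + (1 : A) * u + a₁ * v ∈
            Ideal.map (algebraMap A B) (maximalIdeal A) := by
          have e : (a₀ : B) + ((1 : A) : B) * u + a₁ * v = a₀ + a₁ * v + u := by push_cast; ring
          rw [e]
          exact h
        exact hne (kl_coeff_mem_maximalIdeal_of_mem_map σ bs u v hgen a₀ 1 a₁ h').2.1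
  · push Not at hu
    refine kl_conjecture9_three_core σ u v hgen (fun a₀ a₁ h => ?_) hu
    have h' : (a₀ : B) + a₁ * u + (1 : A) * v ∈ Ideal.map (algebraMap A B) (maximalIdeal A) := by
      have e : (a₀ : B) + a₁ * u + ((1 : A) : B) * v = a₀ + a₁ * u + v := by push_cast; ring
      rw [e]
      exact h
    exact hne (kl_coeff_mem_maximalIdeal_of_mem_map σ bs u v hgen a₀ a₁ 1 h').2.2

/-- **Conjecture 9 of Király–Lütkebohmert is TRUE for `p = 3`** (both directions, packaged): for a
regular local ring `B`, `σ ≠ 1` with `σ³ = 1` and `B` module-finite over `B^σ`, the fixed ring is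
regular iff the augmentation ideal is principal. [cite: KiralyLutkebohmert2013, §3 Conjecture 9 (case p = 3); Thm. 2] -/
theorem kl_isRegularLocalRing_fixed_iff_isPrincipal_three (σ : B ≃+* B) (hσ3 : σ ^ 3 = 1)
    (hσ1 : σ ≠ 1) [Module.Finite ((σ : B →+* B).eqLocus (RingHom.id B)) B] :
    IsRegularLocalRing ((σ : B →+* B).eqLocus (RingHom.id B)) ↔
      (Ideal.span (Set.range fun c : B => σ c - c)).IsPrincipal := by
  constructor
  · intro h
    exact kl_conjecture9_three σ hσ3 hσ1
  · intro h
    exact Literature.AlgebraicGeometry.Resolution.KiralyLutkebohmert2013_thm2_regular_of_isPrincipal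
      Literature.AlgebraicGeometry.Resolution.KiralyLutkebohmert2013_thm2_first_holds
      Literature.AlgebraicGeometry.Resolution.KiralyLutkebohmert2013_thm2_second_holds 3
      Nat.prime_three B σ hσ1 hσ3 h

end Main

end Summit.ResolutionOfSingularities.ResolutionOfSingularities.Theorems
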